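import Literature.Barriers.CriticalPhenomena.RigorousRGSmallParameterSelfSimilarCovariance
import Literature.Barriers.CriticalPhenomena.RigorousRGSmallParameterPerturbativeCoefficientsXi
import HarnessLib

/-!
# `RigorousRGSmallParameter` (Slade, Theorem 1.4.1): lattice Parseval, the Fourier inversion
# `ŵ(t,k;s) = Σ_x w(t,x;s)cos(k·x)`, and the positivity `(C_k, C_m) = Σ_x C_{k;0,x}C_{m;0,x} ≥ 0`

Seventh file of the §10.3–§10.4 layer: the positivity input of Lemma 5.2.2. G. Slade, *Critical
exponents for long-range `O(n)` models below the upper critical dimension*, Commun. Math. Phys. **358**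
(2018), §10.4 (proof of Lemma 5.2.2): "`a = L^ε(8+n)(⟨c₀,c₀⟩ + 2Σ_{k=1}^∞L^{-εk}⟨c₀,c_k⟩)`. … it
follows from the Parseval equality, together with the nonnegativity of the Fourier transform `ĉ₀`,
that each inner product on the right-hand side of (10.48) is nonnegative, with the first term
strictly positive"; and §10.3: "(10.40') `ĉ₀(ξ,m²) = ∫_0^∞dσρ(σ,m²)∫dτ (τ/c²)Φ(τ√(c^{-2}|ξ|²+σ))`.
Consequently, `ĉ₀(ξ,m²)` is nonnegative."

Here the positivity is established ON THE LATTICE, where it is elementary, for the covariances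
`C_j = FRD.fracCov` themselves (`⟨c₀,c_l⟩` is then the limit `lim_k L^{-εk}(C_k, C_{k+l})` of
nonnegative numbers by Lemma 10.3.1; that limit is taken in the sequel):
`(C_k, C_m) := Σ_x C_{k;0,x}C_{m;0,x} = (2π)^{-d}∫_{[-π,π]^d} ĉ_k(θ)ĉ_m(θ)dθ ≥ 0`, where
`ĉ_j(θ) := Σ_x C_{j;0,x}cos(θ·x)` (a finite sum by the finite range) equals
`∫_0^∞ρ(s,m²)∫_{J_j}ŵ(t,θ;s)dt/t ds ≥ 0` (`ŵ ≥ 0` is the tree's `FRD.wHat_nonneg`, "the inequality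
`P_t(ζ) ≥ 0`"). The identity `ĉ_j = ∫ρ∫ŵ/t` rests on the Fourier inversion
`ŵ(t,θ;s) = Σ_x w(t,x;s)cos(θ·x)` for the finite-range kernel, proved here from the polynomial
structure of `ŵ(t,·;s)` in `λ(θ) = 2d(1-μ(θ))` (the tree's `exists_polynomial_chebyProfile`,
degree `≤ ⌊t⌋`), the characteristic function `μ(θ)ⁿ = Σ_x pₙ(x)cos(θ·x)` of simple random walk
(the tree's `hasSum_srwLaw_mul_cos`), and the orthogonality of `cos(θ·x)` on `[-π,π]^d`.

## What this file proves (everything; one definition `FRD.cosSeries`, no named fact)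

* `FRD.setIntegral_cos_phase_mul_cos_phase` (`∫cos(θ·x)cos(θ·x') = ½(2π)^d(𝟙{x=x'}+𝟙{x=-x'})`).
* `FRD.cosSeries` (`Σ_{x∈S}a_xcos(θ·x)`), `FRD.continuous_cosSeries`,
  **`FRD.sum_mul_eq_setIntegral_cosSeries`** (lattice Parseval: `Σ_{x∈S}a_xb_x = (2π)^{-d}∫AB` for
  `S` symmetric, `b` even), `FRD.sum_mul_nonneg_of_cosSeries_nonneg`.
* `FRD.hasSum_polynomial_avgCos` (from the tree's `hasSum_srwLaw_mul_cos`,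
  `μ(θ)ⁿ = Σ_xpₙ(x)cos(θ·x)`), `FRD.coeffSeq_eq_zero`.
* **`FRD.wHat_eq_sum_wKer_mul_cos`** — `ŵ(t,θ;s) = Σ_{|x|₁<R}w(t,x;s)cos(θ·x)` (`R > ⌊t⌋`).
* `FRD.neg_mem_ball`; **`FRD.cosSeries_fracCov_nonneg`** (`ĉ_j ≥ 0`, `j ≥ 2`, any `m²`);
  **`FRD.sum_fracCov_mul_fracCov_nonneg`** (`(C_k,C_m) ≥ 0`, `k, m ≥ 2`, any `m²`);
  `FRD.sum_fracCov_mul_eq_sum_ball` (independence of the summation box).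
-/

noncomputable section

namespace Literature.Barriers.CriticalPhenomena

open _root_.MeasureTheory Set Filter
open scoped _root_.Topology Real

namespace LongRangePhi4

namespace FRD

open Literature.Probability.LatticeModels

variable {d : ℕ}

/-! ### Orthogonality of the cosines on the Brillouin zone -/

/-- **`∫_{[-π,π]^d} cos(k·x)cos(k·x') dk = ½(2π)^d(𝟙{x = x'} + 𝟙{x = -x'})`** for `x, x' ∈ ℤ^d`.
[folklore] -/
theorem setIntegral_cos_phase_mul_cos_phase (x x' : Site d) :
    ∫ k in brillouin d, Real.cos (phase k x) * Real.cos (phase k x') =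
      (2 * π) ^ d / 2 * ((if x = x' then 1 else 0) + (if x = -x' then 1 else 0)) := by
  have hadd : ∀ (k : Fin d → ℝ) (y z : Site d), phase k (y + z) = phase k y + phase k z := by
    intro k y z
    unfold phase
    rw [← Finset.sum_add_distrib]
    refine Finset.sum_congr rfl fun i _ => ?_
    simp only [Pi.add_apply, Int.cast_add]
    ring
  have hsub : ∀ (k : Fin d → ℝ) (y z : Site d), phase k (y - z) = phase k y - phase k z := by
    intro k y z
    rw [sub_eq_add_neg, hadd, phase_neg, ← sub_eq_add_neg]
  have hpt : ∀ k : Fin d → ℝ, Real.cos (phase k x) * Real.cos (phase k x') =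
      (1 / 2 : ℝ) * (Real.cos (phase k (x - x')) + Real.cos (phase k (x + x'))) := by
    intro k
    rw [hsub, hadd, Real.cos_sub, Real.cos_add]
    ring
  simp_rw [hpt]
  have hi : ∀ z : Site d, Integrable (fun k : Fin d → ℝ => Real.cos (phase k z))
      ((volume : Measure (Fin d → ℝ)).restrict (brillouin d)) := fun z =>
    integrableOn_brillouin_of_continuous (Real.continuous_cos.comp (continuous_phase z))
  rw [integral_const_mul, integral_add (hi _) (hi _), setIntegral_cos_phase, setIntegral_cos_phase]
  simp only [sub_eq_zero, add_eq_zero_iff_eq_neg]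
  split_ifs <;> ring

/-! ### Cosine series of finitely supported even sequences: Parseval -/

/-- The (finite) cosine series `A(k) = Σ_{x∈S} a_x cos(k·x)`. [folklore] -/
def cosSeries (a : Site d → ℝ) (S : Finset (Site d)) (k : Fin d → ℝ) : ℝ :=
  ∑ x ∈ S, a x * Real.cos (phase k x)

/-- `k ↦ A(k)` is continuous. [folklore] -/
theorem continuous_cosSeries (a : Site d → ℝ) (S : Finset (Site d)) : Continuous (cosSeries a S) := by
  unfold cosSeries
  exact continuous_finsetSum S fun x _ => continuous_const.mul (Real.continuous_cos.comp (continuous_phase x))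

/-- **Lattice Parseval identity (cosine form)**: for a finite symmetric `S ⊆ ℤ^d` and `b` even,
`Σ_{x∈S} a_x b_x = (2π)^{-d}∫_{[-π,π]^d} A(k)B(k) dk` with `A = Σ_{x∈S}a_xcos(k·x)`,
`B = Σ_{x∈S}b_xcos(k·x)`. [folklore] -/
theorem sum_mul_eq_setIntegral_cosSeries (S : Finset (Site d)) (hS : ∀ x ∈ S, -x ∈ S)
    (a b : Site d → ℝ) (hb : ∀ x, b (-x) = b x) :
    ∑ x ∈ S, a x * b x = ((2 * π) ^ d : ℝ)⁻¹ * ∫ k in brillouin d, cosSeries a S k * cosSeries b S k := by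
  have hπ : (0 : ℝ) < (2 * π) ^ d := by positivity
  -- expand the product of the two finite sums
  have hi : ∀ x x' : Site d, Integrable (fun k : Fin d → ℝ => Real.cos (phase k x) * Real.cos (phase k x'))
      ((volume : Measure (Fin d → ℝ)).restrict (brillouin d)) := fun x x' =>
    integrableOn_brillouin_of_continuous ((Real.continuous_cos.comp (continuous_phase x)).mul
      (Real.continuous_cos.comp (continuous_phase x')))
  have e1 : ∀ k : Fin d → ℝ, cosSeries a S k * cosSeries b S k =
      ∑ x ∈ S, ∑ x' ∈ S, a x * b x' * (Real.cos (phase k x) * Real.cos (phase k x')) := by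
    intro k
    unfold cosSeries
    rw [Finset.sum_mul_sum]
    refine Finset.sum_congr rfl fun x _ => Finset.sum_congr rfl fun x' _ => by ring
  simp_rw [e1]
  rw [integral_finsetSum S fun x _ => integrable_finsetSum S fun x' _ => (hi x x').const_mul _]
  have e2 : ∀ x ∈ S, ∫ k in brillouin d, ∑ x' ∈ S, a x * b x' * (Real.cos (phase k x) * Real.cos (phase k x')) =
      (2 * π) ^ d / 2 * (a x * (b x + b (-x))) := by
    intro x hx
    rw [integral_finsetSum S fun x' _ => (hi x x').const_mul _]
    simp_rw [integral_const_mul, setIntegral_cos_phase_mul_cos_phase]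
    have h1 : ∑ x' ∈ S, a x * b x' * ((2 * π) ^ d / 2 * ((if x = x' then 1 else 0) + (if x = -x' then 1 else 0))) =
        (2 * π) ^ d / 2 * a x * (∑ x' ∈ S, b x' * (if x = x' then 1 else 0) +
          ∑ x' ∈ S, b x' * (if x = -x' then 1 else 0)) := by
      rw [← Finset.sum_add_distrib, Finset.mul_sum]
      refine Finset.sum_congr rfl fun x' _ => by ring
    rw [h1]
    have h2 : ∑ x' ∈ S, b x' * (if x = x' then (1 : ℝ) else 0) = b x := by
      rw [Finset.sum_eq_single x (fun x' _ hne => by rw [if_neg (Ne.symm hne), mul_zero])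
        (fun h => absurd hx h)]
      simp
    have h3 : ∑ x' ∈ S, b x' * (if x = -x' then (1 : ℝ) else 0) = b (-x) := by
      rw [Finset.sum_eq_single (-x) (fun x' _ hne => by
        rw [if_neg (fun h => hne (by rw [h, neg_neg])), mul_zero]) (fun h => absurd (hS x hx) h)]
      simp
    rw [h2, h3]
    ring
  rw [Finset.sum_congr rfl e2, ← Finset.mul_sum, ← mul_assoc, show ((2 * π) ^ d : ℝ)⁻¹ * ((2 * π) ^ d / 2) = 1 / 2 by
    field_simp]
  rw [Finset.mul_sum]
  refine Finset.sum_congr rfl fun x _ => ?_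
  rw [hb x]
  ring

/-- In particular `Σ_{x∈S} a_x² = (2π)^{-d}∫A² ≥ 0`-type positivity: if `A, B ≥ 0` pointwise then
`Σ_{x∈S} a_x b_x ≥ 0`. [folklore] -/
theorem sum_mul_nonneg_of_cosSeries_nonneg (S : Finset (Site d)) (hS : ∀ x ∈ S, -x ∈ S)
    (a b : Site d → ℝ) (hb : ∀ x, b (-x) = b x) (hA : ∀ k ∈ brillouin d, 0 ≤ cosSeries a S k)
    (hB : ∀ k ∈ brillouin d, 0 ≤ cosSeries b S k) : 0 ≤ ∑ x ∈ S, a x * b x := by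
  rw [sum_mul_eq_setIntegral_cosSeries S hS a b hb]
  exact mul_nonneg (by positivity) (setIntegral_nonneg (measurableSet_brillouin d)
    fun k hk => mul_nonneg (hA k hk) (hB k hk))

/-! ### A polynomial in `μ(k)` is a finite cosine series -/

/-- For a real polynomial `r` with `natDegree r ≤ N`: `r(μ(k)) = Σ_x b_x cos(k·x)` (as a `HasSum`)
with `b_x = Σ_{i≤N} r_i pᵢ(x)`, an even sequence supported in `|x|₁ ≤ N`. [folklore] -/
theorem hasSum_polynomial_avgCos (hd : 1 ≤ d) (r : Polynomial ℝ) {N : ℕ} (hN : r.natDegree ≤ N)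
    (k : Fin d → ℝ) :
    HasSum (fun x : Site d => (∑ i ∈ Finset.range (N + 1), r.coeff i * srwLaw d i x) * Real.cos (phase k x))
      (r.eval (avgCos d k)) := by
  rw [Polynomial.eval_eq_sum_range' (Nat.lt_succ_of_le hN)]
  have h : HasSum (fun x : Site d => ∑ i ∈ Finset.range (N + 1), r.coeff i * (srwLaw d i x * Real.cos (phase k x)))
      (∑ i ∈ Finset.range (N + 1), r.coeff i * avgCos d k ^ i) :=
    hasSum_sum fun i _ => (hasSum_srwLaw_mul_cos hd k i).mul_left _
  refine h.congr_fun fun x => ?_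
  rw [Finset.sum_mul]
  refine Finset.sum_congr rfl fun i _ => by ring

/-- The coefficient sequence `b_x = Σ_{i≤N} r_i pᵢ(x)` vanishes for `|x|₁ > N`. [folklore] -/
theorem coeffSeq_eq_zero {r : Polynomial ℝ} {N : ℕ} {x : Site d} (hx : N < ∑ i, (x i).natAbs) :
    ∑ i ∈ Finset.range (N + 1), r.coeff i * srwLaw d i x = 0 := by
  refine Finset.sum_eq_zero fun i hi => ?_
  rw [Finset.mem_range] at hi
  rw [srwLaw_eq_zero_of_lt i x (by omega), mul_zero]

/-! ### The Fourier inversion `ŵ(t,k;s) = Σ_x w(t,x;s)cos(k·x)` -/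

/-- **The symbol of the finite-range kernel is its own (finite) cosine series**:
for `t > 0`, `s > 0` and `R > ⌊t⌋`, `ŵ(t,k;s) = Σ_{|x|₁<R} w(t,x;s)cos(k·x)` for every `k`
(`ŵ(t,·;s)` is a polynomial of degree `≤ ⌊t⌋` in `λ(k) = 2d(1-μ(k))`, hence a cosine series with
coefficients supported in `|x|₁ ≤ ⌊t⌋`; by orthogonality the coefficients are
`(2π)^{-d}∫ŵcos(k·x) = w(t,x;s)`). [cite: Slade2017, §3.1 (finite range (3.1) via polynomials in Δ)] -/
theorem wHat_eq_sum_wKer_mul_cos (hd : 1 ≤ d) {s : ℝ} (hs : 0 < s) {t : ℝ} (ht : 0 < t) {R : ℝ}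
    (hR : (⌊t⌋₊ : ℝ) < R) (k : Fin d → ℝ) :
    wHat d s t k = ∑ x ∈ PT.ball R, wKer d s t x * Real.cos (phase k x) := by
  have hd' : (0 : ℝ) < d := by exact_mod_cast hd
  have hM : (0 : ℝ) < 2 * d + s := by positivity
  obtain ⟨q, hqdeg, hq⟩ := exists_polynomial_chebyProfile profile conj_profile profile_neg
    (fun _ hη => fourier_profile_eq_zero hη.le) ht
  set N : ℕ := ⌊t⌋₊ with hN
  -- `ŵ(t,k) = (t²/(cM²)) q((2d(1-μ)+s)/M²) = r(μ)` with `r` of degree ≤ N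
  set aff : Polynomial ℝ := Polynomial.C ((2 * d + s) / (2 * d + s)) - Polynomial.C (2 * d / (2 * d + s)) * Polynomial.X
    with haff
  set r : Polynomial ℝ := Polynomial.C (t ^ 2 / (cProfile * (2 * d + s))) * q.comp aff with hr
  have haffdeg : aff.natDegree ≤ 1 := by
    rw [haff]
    refine (Polynomial.natDegree_sub_le _ _).trans (max_le (by simp) ?_)
    exact (Polynomial.natDegree_C_mul_le _ _).trans Polynomial.natDegree_X_le
  have hrdeg : r.natDegree ≤ N := by
    rw [hr]
    refine (Polynomial.natDegree_C_mul_le _ _).trans ?_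
    refine (Polynomial.natDegree_comp_le).trans ?_
    calc q.natDegree * aff.natDegree ≤ N * 1 := Nat.mul_le_mul hqdeg haffdeg
      _ = N := mul_one N
  have hwr : ∀ k' : Fin d → ℝ, wHat d s t k' = r.eval (avgCos d k') := by
    intro k'
    have hmem : (laplaceSymbol k' + s) / (2 * d + s) ∈ Icc (0 : ℝ) 4 := by
      obtain ⟨h0, h4⟩ := spectralArg_mem hs k'
      exact ⟨h0.le, h4.le⟩
    unfold wHat
    rw [hq _ hmem, hr, Polynomial.eval_mul, Polynomial.eval_C, Polynomial.eval_comp]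
    congr 2
    rw [haff, laplaceSymbol_eq_avgCos hd]
    simp only [Polynomial.eval_sub, Polynomial.eval_C, Polynomial.eval_mul, Polynomial.eval_X]
    field_simp
    ring
  -- the coefficient sequence
  set b : Site d → ℝ := fun x => ∑ i ∈ Finset.range (N + 1), r.coeff i * srwLaw d i x with hb
  have hbsum : ∀ k' : Fin d → ℝ, HasSum (fun x : Site d => b x * Real.cos (phase k' x)) (wHat d s t k') := by
    intro k'
    rw [hwr k']
    exact hasSum_polynomial_avgCos hd r hrdeg k'
  have hbzero : ∀ x : Site d, x ∉ PT.ball R → b x = 0 := by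
    intro x hx
    rw [PT.mem_ball, not_lt] at hx
    have : N < ∑ i, (x i).natAbs := by exact_mod_cast lt_of_lt_of_le hR hx
    exact coeffSeq_eq_zero this
  have hbfin : ∀ k' : Fin d → ℝ, wHat d s t k' = cosSeries b (PT.ball R) k' := by
    intro k'
    have := (hbsum k').tsum_eq
    rw [← this, tsum_eq_sum (s := PT.ball R) fun x hx => by rw [hbzero x hx, zero_mul]]
    rfl
  have hbeven : ∀ x, b (-x) = b x := by
    intro x
    simp only [hb, srwLaw_neg hd]
  -- identify `b = w(t,·;s)` by orthogonality
  have hS : ∀ x : Site d, x ∈ PT.ball R → -x ∈ PT.ball R := by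
    intro x hx
    rw [PT.mem_ball] at hx ⊢
    simpa [Int.natAbs_neg] using hx
  have hbw : ∀ x : Site d, wKer d s t x = b x := by
    intro x
    -- `w(t,x) = (2π)^{-d}∫ŵcos(k·x) = (2π)^{-d}∫ B(k) A_x(k)` with `A_x = cos(k·x)` the series of `δ_x`
    by_cases hxR : x ∈ PT.ball R
    · have h1 : wKer d s t x = ((2 * π) ^ d : ℝ)⁻¹ * ∫ k' in brillouin d,
          cosSeries (fun y => if y = x then 1 else 0) (PT.ball R) k' * cosSeries b (PT.ball R) k' := by
        unfold wKer
        congr 1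
        refine integral_congr_ae (Eventually.of_forall fun k' => ?_)
        show wHat d s t k' * Real.cos (phase k' x) =
          cosSeries (fun y => if y = x then 1 else 0) (PT.ball R) k' * cosSeries b (PT.ball R) k'
        rw [hbfin k', mul_comm]
        congr 1
        unfold cosSeries
        rw [Finset.sum_eq_single x (fun y _ hne => by simp only [if_neg hne, zero_mul]) (fun h => absurd hxR h)]
        simp
      have h2 := sum_mul_eq_setIntegral_cosSeries (PT.ball R) hS (fun y => if y = x then (1 : ℝ) else 0) b hbeven
      rw [h1, ← h2, Finset.sum_eq_single x (fun y _ hne => by simp only [if_neg hne, zero_mul]) (fun h => absurd hxR h)]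
      simp
    · rw [hbzero x hxR]
      rw [PT.mem_ball, not_lt] at hxR
      exact wKer_eq_zero hd hs.le ht x (by exact_mod_cast lt_of_lt_of_le hR hxR)
  rw [hbfin k]
  unfold cosSeries
  refine Finset.sum_congr rfl fun x _ => by rw [hbw x]


/-! ### The symbol of `C_j` is nonnegative; positivity of `(C_k, C_m)` -/

/-- `PT.ball R` is symmetric. [folklore] -/
theorem neg_mem_ball {R : ℝ} (x : Site d) (hx : x ∈ PT.ball R) : -x ∈ PT.ball R := by
  rw [PT.mem_ball] at hx ⊢
  simpa [Int.natAbs_neg] using hx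

/-- **The (cosine) symbol of `C_j` is nonnegative**: for `j ≥ 2`, `L ≥ 2`, any `m²`, any `R > ½L^j`
and every `k`, `Σ_{|x|₁<R} C_{j;0,x}(m²) cos(k·x) = ∫_0^∞ρ(s,m²)∫_{J_j}ŵ(t,k;s)dt/t ds ≥ 0`
(`ŵ ≥ 0`, `ρ ≥ 0`, and `ŵ(t,·;s) = Σ_x w(t,x;s)cos(k·x)`). [cite: Slade2017, §3.1 ("Each Γ_j is a positive semi-definite ℤ^d × ℤ^d matrix") and §10.3 ("Consequently, ĉ₀(ξ,m²) is nonnegative")] -/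
theorem cosSeries_fracCov_nonneg (hd : 1 ≤ d) {α : ℝ} (hα0 : 0 < α) (hα2 : α < 2) {L : ℝ} (hL : 2 ≤ L)
    {j : ℕ} (hj : 2 ≤ j) (m2 : ℝ) {R : ℝ} (hR : L ^ j / 2 < R) (k : Fin d → ℝ) :
    0 ≤ cosSeries (fracCov d L α m2 j) (PT.ball R) k := by
  have hβ0 : 0 < α / 2 := by positivity
  have hβ1 : α / 2 < 1 := by linarith
  have hL0 : (0 : ℝ) < L := by linarith
  unfold cosSeries
  -- pull the finite `x`-sum inside the `s`-integral
  have hint : ∀ x : Site d, IntegrableOn (fun s : ℝ => Gam d L s j x * Kato.katoDensity (α / 2) m2 s) (Ioi 0) :=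
    fun x => integrableOn_Gam_mul_katoDensity_of_two_le hd hβ0 hβ1 hL hj m2 x
  have e1 : ∑ x ∈ PT.ball R, fracCov d L α m2 j x * Real.cos (phase k x) =
      ∫ s in Ioi 0, (∑ x ∈ PT.ball R, Gam d L s j x * Real.cos (phase k x)) * Kato.katoDensity (α / 2) m2 s := by
    unfold fracCov
    simp_rw [Finset.sum_mul]
    rw [integral_finsetSum _ fun x _ => ((hint x).mul_const (Real.cos (phase k x))).congr
      (Eventually.of_forall fun s => by ring)]
    refine Finset.sum_congr rfl fun x _ => ?_
    rw [← integral_mul_const]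
    exact integral_congr_ae (Eventually.of_forall fun s => by ring)
  rw [e1]
  refine setIntegral_nonneg measurableSet_Ioi fun s hs => ?_
  have hs0 : (0 : ℝ) < s := hs
  refine mul_nonneg ?_ (Kato.katoDensity_pos hβ0 hβ1 m2 hs0).le
  -- the `x`-sum inside the `t`-integral is `ŵ(t,k;s) ≥ 0`
  have hlo : (0 : ℝ) ≤ L ^ (j - 1) / 2 := by positivity
  have hti : ∀ x : Site d, IntegrableOn (fun t : ℝ => wKer d s t x / t) (Ioc (L ^ (j - 1) / 2) (L ^ j / 2)) :=
    fun x => integrableOn_wKer_div_Ioc hs0 x hlo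
  have e2 : ∑ x ∈ PT.ball R, Gam d L s j x * Real.cos (phase k x) =
      ∫ t in Ioc (L ^ (j - 1) / 2) (L ^ j / 2), wHat d s t k / t := by
    simp_rw [Slade2017_display106 L s hj, ← integral_mul_const]
    rw [← integral_finsetSum _ fun x _ => (hti x).mul_const _]
    refine setIntegral_congr_fun measurableSet_Ioc fun t ht => ?_
    have ht0 : 0 < t := lt_of_le_of_lt hlo ht.1
    have hfl : (⌊t⌋₊ : ℝ) < R := lt_of_le_of_lt ((Nat.floor_le ht0.le).trans ht.2) hR
    rw [wHat_eq_sum_wKer_mul_cos hd hs0 ht0 hfl k, Finset.sum_div]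
    refine Finset.sum_congr rfl fun x _ => by ring
  rw [e2]
  refine setIntegral_nonneg measurableSet_Ioc fun t ht => ?_
  have ht0 : 0 < t := lt_of_le_of_lt hlo ht.1
  exact div_nonneg (wHat_nonneg hs0.le t k) ht0.le

/-- **`(C_k, C_m) = Σ_x C_{k;0,x}C_{m;0,x} ≥ 0`** for `k, m ≥ 2` (any `m²`, `L ≥ 2`): by the lattice
Parseval identity the sum is `(2π)^{-d}∫` of the product of the two nonnegative symbols. This is the
lattice source of the positivity "each inner product `⟨c₀, c_k⟩` … is nonnegative" in Lemma 5.2.2.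
[cite: Slade2017, Lemma 5.2.2 (proof, §10.4: "it follows from the Parseval equality, together with the nonnegativity of the Fourier transform ĉ₀, that each inner product … is nonnegative")] -/
theorem sum_fracCov_mul_fracCov_nonneg (hd : 1 ≤ d) {α : ℝ} (hα0 : 0 < α) (hα2 : α < 2) {L : ℝ}
    (hL : 2 ≤ L) {k m : ℕ} (hk : 2 ≤ k) (hm : 2 ≤ m) (m2 : ℝ) {R : ℝ} (hRk : L ^ k / 2 < R)
    (hRm : L ^ m / 2 < R) :
    0 ≤ ∑ x ∈ PT.ball R, fracCov d L α m2 k x * fracCov d L α m2 m x :=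
  sum_mul_nonneg_of_cosSeries_nonneg (PT.ball R) (fun x hx => neg_mem_ball x hx) _ _
    (fun x => PT.fracCov_neg d L α m2 m x) (fun θ _ => cosSeries_fracCov_nonneg hd hα0 hα2 hL hk m2 hRk θ)
    (fun θ _ => cosSeries_fracCov_nonneg hd hα0 hα2 hL hm m2 hRm θ)

/-- The same sum over any finite set containing the ball `|x|₁ < ½L^k` (outside it `C_k` vanishes),
in particular it does not depend on `R`. [cite: Slade2017, Proposition 3.3.1 (finite range)] -/
theorem sum_fracCov_mul_eq_sum_ball (hd : 1 ≤ d) {L : ℝ} (hL : 1 ≤ L) (α m2 : ℝ) {k : ℕ} (m : ℕ)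
    {R : ℝ} (hRk : L ^ k / 2 ≤ R) (S : Finset (Site d)) (hS : PT.ball R ⊆ S) :
    ∑ x ∈ S, fracCov d L α m2 k x * fracCov d L α m2 m x =
      ∑ x ∈ PT.ball R, fracCov d L α m2 k x * fracCov d L α m2 m x := by
  symm
  refine Finset.sum_subset hS fun x _ hx => ?_
  rw [PT.mem_ball, not_lt] at hx
  rw [fracCov_eq_zero_of_le hd (by linarith) α m2 k x (hRk.trans hx), zero_mul]

end FRD

end LongRangePhi4

end Literature.Barriers.CriticalPhenomena
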